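import Summits.BirchSwinnertonDyer.BirchSwinnertonDyer.Theses.KolyvaginRankRigidityAtTwo
import Literature.NumberTheory.EllipticCurves.HeegnerPointsOfConductorOneGaloisConjProofs
import HarnessLib

/-!
# Crux V2 `KolyvaginCorankRigidityAtTwo` (stmt-BirchSwinnertonDyer-23949), line `kolyvagin-depth-split`,
# stub `stub_depthZero`: the depth-zero case of Kolyvagin's structure theorem at `2`

At a non-zero conductor-`1` class `c_M(1) ≠ 0` of the Heegner-point Kolyvagin system at `p = 2`
the corank pair `(c, c') = (corank Sel_{2^∞}(E/ℚ), corank Sel_{2^∞}(E^{(d_K)}/ℚ))` is `(1, 0)` or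
`(0, 1)` — V2's dichotomy at `ν = 0`. Proof (Kolyvagin 1990 Thm. A at every prime, here through
the route's printed inputs): `c_M(1) ≠ 0` forces `P(1) = y_K` non-torsion (Gross 1991 Prop. 4.7
(1): a torsion `P(1)` is `2^M`-divisible in the admissible group `E(K[1])`, tree theorem
`heegnerSystem_kolyvaginClass_eq_zero_of_isOfFinAddOrder`; reciprocity at conductor `1` is the
tree theorem `heegnerPointOfConductor_one_galoisConj_holds`), so `ord_{s=1} L(E/K, s) = 1` by
Gross–Zagier (`analyticRankEK_eq_one_iff_heegner_nonTorsion`, hypothesis), so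
`ord L(E) + ord L(E^{(d_K)}) = 1` (`analyticRankEK_eq_add_of`, entire `L`, hypothesis), so by
Gross–Zagier–Kolyvagin over `ℚ` (`rank_eq_analyticRank_of_analyticRank_le_one`, hypothesis) both
curves have `rank = ord` and finite `Ш`, whence `corank Sel_{2^∞} = rank`
(`selmerCorank_eq_mordellWeilRank_add_holds`, Greenberg 1999 §1).

HONEST FRAMING: conditional on the three displayed printed inputs (all already hypotheses of
the route's `closes` via `PrintedInputsRankOneAtTwo` / `MultPublishedInputsAtTwo`); this is the
EASY end of V2 — the positive-depth stubs carry the beyond-print content. BSD is not proved here.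
-/

set_option autoImplicit false
-- the Theorems namespace of this sub repeats the summit name by design (D-0017 nested layout)
set_option linter.dupNamespace false

noncomputable section

open scoped Classical

open WeierstrassCurve Literature.NumberTheory.EllipticCurves
  Literature.NumberTheory.EllipticCurves.ModularForms
open Summit.BirchSwinnertonDyer.BirchSwinnertonDyer.Theses.KolyvaginRankRigidityAtTwo

namespace Summit.BirchSwinnertonDyer.BirchSwinnertonDyer.Theorems.KolyvaginRankRigidity

/-- **Depth `ν = 0` of V2, modulo the route's printed inputs.** For `W/ℚ` globally minimal
elliptic, `K` imaginary quadratic with the Heegner hypothesis for `N_E`, granted Gross–Zagier in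
the form `ord_{s=1} L(E/K,s) = 1 ↔ y_K` non-torsion for `(W, N_E, K)`, the entire continuation of
`L(E,s)` (for `ord L(E/K) = ord L(E) + ord L(E^{(d_K)})`) and Gross–Zagier–Kolyvagin over `ℚ`
(`rank = ord ≤ 1`, `Ш` finite): if a conductor-`1` Kolyvagin class `c_M(n) ≠ 0` with
`#(ℓ ∣ n) = 0` (so `n = 1`) is non-zero, then `(c, c') ∈ {(1,0), (0,1)}` in V2's currency.
[cite: GrossLMS1991, Prop. 4.7 (1) and §4 (P_1 = y_K)] [cite: Kolyvagin1990, Thm. A] -/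
theorem stub_depthZero :
    ∀ (W : WeierstrassCurve ℚ) [W.IsElliptic] [W.IsGloballyMinimal] (K : Type) [Field K]
      [NumberField K], IsImaginaryQuadratic K → ∀ [NeZero (W.conductorNorm ℤ)],
      SatisfiesHeegnerHypothesis (W.conductorNorm ℤ) K →
      analyticRankEK_eq_one_iff_heegner_nonTorsion W (W.conductorNorm ℤ) K →
      WeierstrassCurve.hasEntireLFunction_rat →
      rank_eq_analyticRank_of_analyticRank_le_one →
      ∀ (Dt : ModularParametrizationData W (W.conductorNorm ℤ)) (β : ℤ) (ι : K →+* ℂ) (n : ℕ)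
        (d : KolyvaginHeegnerData Dt β ι n) (M : ℕ),
        KolyvaginDescent.KolSupp (Zhang2014.IsKolyvaginPrime (W.conductorNorm ℤ) W K 2) n →
        d.kolyvaginClass Nat.prime_two M ≠ 0 → n.primeFactors.card = 0 →
        ((W.selmerCorank 2 = n.primeFactors.card + 1 ∧
            (W.quadraticTwist (NumberField.discr K : ℚ)).selmerCorank 2 ≤ n.primeFactors.card) ∨
          ((W.quadraticTwist (NumberField.discr K : ℚ)).selmerCorank 2 = n.primeFactors.card + 1 ∧
            W.selmerCorank 2 ≤ n.primeFactors.card)) := by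
  intro W _ _ K _ _ hK _ hHN hGZ hE hGZK Dt β ι n d M hn hne hν
  -- `n` is square-free with no prime factor: `n = 1`
  have hn1 : n = 1 := by
    rw [Finset.card_eq_zero, Nat.primeFactors_eq_empty] at hν
    rcases hν with h0 | h1
    · exact absurd (h0 ▸ hn.1) not_squarefree_zero
    · exact h1
  subst hn1
  rw [hν]
  haveI : Fact (Nat.Prime 2) := ⟨Nat.prime_two⟩
  -- the bottom class reads `ord_{s=1} L(E/K, s) = 1` (reciprocity at conductor 1 is a tree theorem)
  have hEK : analyticRankEK W K = 1 :=
    heegnerSystem_analyticRankEK_eq_one_of_kolyvaginClass_one_ne_zero hGZ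
      (heegnerPointOfConductor_one_galoisConj_holds _ W K) hK rfl hHN d hne
  rw [analyticRankEK_eq_add_of hE W K] at hEK
  have hd : (NumberField.discr K : ℚ) ≠ 0 := by exact_mod_cast NumberField.discr_ne_zero K
  haveI := W.isElliptic_quadraticTwist hd
  -- Gross–Zagier–Kolyvagin over `ℚ` for `E` and for `E^{(d_K)}` (both have analytic rank `≤ 1`)
  obtain ⟨hrk, hsha⟩ := hGZK W (by omega)
  obtain ⟨hrk', hsha'⟩ := hGZK (W.quadraticTwist (NumberField.discr K : ℚ)) (by omega)
  haveI := hsha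
  haveI := hsha'
  rcases Nat.eq_zero_or_pos W.analyticRank with h0 | hpos
  · -- `ord L(E) = 0`, `ord L(E^{(d_K)}) = 1`
    have h1 : (W.quadraticTwist (NumberField.discr K : ℚ)).analyticRank = 1 := by omega
    have hc' : (W.quadraticTwist (NumberField.discr K : ℚ)).selmerCorank 2 = 1 :=
      selmerCorank_eq_one_of_mordellWeilRank_eq_one_of_finite _ 2 (hrk'.trans h1) inferInstance
    have hc : W.selmerCorank 2 = 0 := by
      rw [W.selmerCorank_eq_mordellWeilRank_add_holds 2, hrk, h0,
        (finite_primaryComponent_sha_iff_shaCorank_eq_zero W 2).1 inferInstance]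
    omega
  · -- `ord L(E) = 1`, `ord L(E^{(d_K)}) = 0`
    have h1 : W.analyticRank = 1 := by omega
    have h0 : (W.quadraticTwist (NumberField.discr K : ℚ)).analyticRank = 0 := by omega
    have hc : W.selmerCorank 2 = 1 :=
      selmerCorank_eq_one_of_mordellWeilRank_eq_one_of_finite _ 2 (hrk.trans h1) inferInstance
    have hc' : (W.quadraticTwist (NumberField.discr K : ℚ)).selmerCorank 2 = 0 := by
      rw [(W.quadraticTwist (NumberField.discr K : ℚ)).selmerCorank_eq_mordellWeilRank_add_holds 2,
        hrk', h0, (finite_primaryComponent_sha_iff_shaCorank_eq_zero _ 2).1 inferInstance]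
    omega

end Summit.BirchSwinnertonDyer.BirchSwinnertonDyer.Theorems.KolyvaginRankRigidity
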